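import Literature.Claims.NS.Aksman2026
import Literature.Analysis.FluidPDE.Vorticity
import Literature.Analysis.FluidPDE.VorticityCalculus
import Literature.Analysis.FluidPDE.VectorCalculusProofs
import Literature.Analysis.FluidPDE.NSLerayHopfSereginEnergyProofs

/-!
# NS-CLAIMS C175 `Aksman2026` — refuter of record (ns-claims-refuter-3 g6): `¬ Step_repr_exact`

Cell `ns-claims` (D-0090), row C175, text of record Zenodo 21263950 (PDF sha16 4dc47ee78d4116b9, 7 pp.),
skeleton of record `Literature/Claims/NS/Aksman2026.lean` = p552632 (sha16 1ce8cc8410eff184, 331 l.),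
composition of record `claim_of_steps (hex : Step_repr_exact) (hC2 : Step_C2) (h47 : Step_T47) (hT5 : Step_T5)
(h12 : Step_12) (hdyn : Step_repr_dyn) (hBKM : Step_BKM) : ClaimedTheorem` (l.274; every binder consumed).
VERDICT OBJECT `not_Step_repr_exact`: first failing step = `Literature.Claims.NS.Aksman2026.Step_repr_exact`
(p.3 l.38–39 «By the Density Theorem (Section 4), vorton fields are complete in the solenoidal Hilbert space.
This is an exact representation of the vorticity, not a modeling ansatz» with (5) p.3 l.31–37 / (2) p.2
l.40–49, AS USED for «arbitrary smooth divergence-free initial data» Thm 11 p.6 l.18) (print p.3), class =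
false lemma (countermodel).
MECHANISM. §1 a finite superposition of kernels that are additive in the intensity, continuous off the
position and unbounded near the position for a nonzero intensity is identically zero or unbounded off the
positions (`SingularKernel.dichotomy`: regroup by position; all net intensities zero ⇒ sum `0`; else near a
position of net intensity `γ ≠ 0` the rest is bounded and the kernel blows up). §2 the printed vorton velocity
(2) (= the skeleton's `vortonVel`, = the tree's `biotSavartKernel (x − r) γ`) is such a kernel:
`‖v(r + s e)‖ = ‖γ‖/(4π s²)` for a unit `e ⊥ γ`. §3 the witness `u₀ = curl (φ Ψ)`, `Ψ(x) = −½(x₀² + x₁²) e₂`,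
`φ` a smooth bump `≡ 1` on `B(0,3)`: `C^∞`, divergence-free, compactly supported (Fefferman class (4)), equal
to the rigid rotation `(−x₁, x₀, 0)` on `B(0,3)` (nonzero at `t e₀`, `0 < t < 3`), bounded — a genuine datum,
not the zero field (RULINGS v1.50 (h5)). §4 an a.e. identity `u₀ = superpos R Γ` upgrades to a pointwise one
off the finitely many poles (continuity + Lebesgue measure charges open sets), contradicting §1.
WHAT THIS IS NOT: not a claim about NS regularity or blow-up; not a claim about any author beyond the
typed locator.
-/

open Literature.Analysis Literature.Analysis.FluidPDE
open Metric Set Filter Topology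
open scoped ContDiff RealInnerProductSpace

set_option linter.dupNamespace false

namespace Summit.NavierStokesRegularity.NavierStokesRegularity.Theorems.Aksman2026

noncomputable section

open Literature.Claims.NS.Aksman2026 (E3)

/-! ## 1. The dichotomy for finite superpositions of singular kernels -/

/-- The properties of a vorton-type kernel `K γ p x` (intensity, position, field point) used below. -/
structure SingularKernel (K : E3 → E3 → E3 → E3) : Prop where
  add : ∀ γ γ' p x, K (γ + γ') p x = K γ p x + K γ' p x
  zero : ∀ p x, K 0 p x = 0
  cont : ∀ γ p x, x ≠ p → ContinuousAt (K γ p) x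
  blowup : ∀ γ p, γ ≠ 0 → ∀ M δ : ℝ, 0 < δ → ∃ x, x ≠ p ∧ dist x p < δ ∧ M < ‖K γ p x‖

namespace SingularKernel

variable {K : E3 → E3 → E3 → E3}

/-- Additivity over a finite family of intensities at one position. -/
theorem sum (hK : SingularKernel K) {ι : Type*} (s : Finset ι) (γ : ι → E3) (p x : E3) :
    ∑ i ∈ s, K (γ i) p x = K (∑ i ∈ s, γ i) p x := by
  classical
  induction s using Finset.induction_on with
  | empty => simp [hK.zero]
  | insert a s ha ih => rw [Finset.sum_insert ha, Finset.sum_insert ha, hK.add, ih]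

/-- **Dichotomy.** A finite superposition of singular kernels is `0`, or unbounded off the positions. -/
theorem dichotomy (hK : SingularKernel K) {ι : Type*} [Fintype ι] (γ r : ι → E3) :
    (∀ x, ∑ i, K (γ i) (r i) x = 0) ∨
    (∀ C : ℝ, ∃ x, (∀ i, x ≠ r i) ∧ C < ‖∑ i, K (γ i) (r i) x‖) := by
  classical
  set P : Finset E3 := Finset.univ.image r with hP
  set net : E3 → E3 := fun p => ∑ i ∈ Finset.univ.filter (fun i => r i = p), γ i with hnet
  have hregroup : ∀ x, ∑ i, K (γ i) (r i) x = ∑ p ∈ P, K (net p) p x := by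
    intro x
    rw [← Finset.sum_fiberwise_of_maps_to (s := Finset.univ) (t := P) (g := r)
      (fun i hi => Finset.mem_image_of_mem r hi)]
    refine Finset.sum_congr rfl fun p _ => ?_
    rw [hnet, ← hK.sum]
    refine Finset.sum_congr rfl fun i hi => ?_
    rw [(Finset.mem_filter.1 hi).2]
  by_cases hall : ∀ p ∈ P, net p = 0
  · left
    intro x
    rw [hregroup x]
    exact Finset.sum_eq_zero fun p hp => by rw [hall p hp, hK.zero]
  · right
    push Not at hall
    obtain ⟨p₀, hp₀P, hp₀⟩ := hall
    intro C
    set rest : E3 → E3 := fun x => ∑ p ∈ P.erase p₀, K (net p) p x with hrest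
    have hrest_cont : ContinuousAt rest p₀ :=
      tendsto_finsetSum (P.erase p₀) fun p hp => hK.cont (net p) p p₀ (Finset.ne_of_mem_erase hp).symm
    obtain ⟨δ₁, hδ₁, hδ₁b⟩ : ∃ δ₁ > 0, ∀ x, dist x p₀ < δ₁ → dist (rest x) (rest p₀) < 1 :=
      Metric.continuousAt_iff.1 hrest_cont 1 one_pos
    obtain ⟨δ₂, hδ₂, hδ₂b⟩ : ∃ δ₂ > 0, ∀ p ∈ P.erase p₀, δ₂ ≤ dist p p₀ := by
      have hclosed : IsClosed ((P.erase p₀ : Finset E3) : Set E3) :=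
        (P.erase p₀).finite_toSet.isClosed
      have hnot : p₀ ∈ ((P.erase p₀ : Finset E3) : Set E3)ᶜ := by simp
      obtain ⟨δ, hδ, hball⟩ := Metric.isOpen_iff.1 hclosed.isOpen_compl p₀ hnot
      refine ⟨δ, hδ, fun p hp => ?_⟩
      by_contra hlt
      push Not at hlt
      exact hball (Metric.mem_ball.2 hlt) hp
    obtain ⟨x, hxp, hxd, hxM⟩ :=
      hK.blowup (net p₀) p₀ hp₀ (C + ‖rest p₀‖ + 1) (min δ₁ δ₂) (lt_min hδ₁ hδ₂)
    refine ⟨x, fun i => ?_, ?_⟩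
    · intro hxi
      by_cases hi : r i = p₀
      · exact hxp (hxi.trans hi)
      · have hmem : r i ∈ P.erase p₀ :=
          Finset.mem_erase.2 ⟨hi, Finset.mem_image_of_mem r (Finset.mem_univ i)⟩
        have h := hδ₂b _ hmem
        rw [← hxi] at h
        exact absurd (lt_of_lt_of_le (lt_min_iff.1 hxd).2 h) (lt_irrefl _)
    · rw [hregroup x, ← Finset.add_sum_erase P _ hp₀P]
      show C < ‖K (net p₀) p₀ x + rest x‖
      have h1 : dist (rest x) (rest p₀) < 1 := hδ₁b x (lt_min_iff.1 hxd).1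
      rw [dist_eq_norm] at h1
      have h2 : ‖rest x‖ ≤ ‖rest x - rest p₀‖ + ‖rest p₀‖ := by
        simpa using norm_add_le (rest x - rest p₀) (rest p₀)
      have h3 : ‖K (net p₀) p₀ x‖ ≤ ‖K (net p₀) p₀ x + rest x‖ + ‖rest x‖ := by
        simpa using norm_sub_le (K (net p₀) p₀ x + rest x) (rest x)
      linarith

/-- A BOUNDED function, nonzero somewhere off the positions, is no finite superposition off the positions. -/
theorem not_repr (hK : SingularKernel K) {u : E3 → E3} {C : ℝ} (hC : ∀ x, ‖u x‖ ≤ C)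
    {ι : Type*} [Fintype ι] (γ r : ι → E3) {x₁ : E3} (hx₁ : ∀ i, x₁ ≠ r i) (hu : u x₁ ≠ 0)
    (hrep : ∀ x, (∀ i, x ≠ r i) → u x = ∑ i, K (γ i) (r i) x) : False := by
  rcases hK.dichotomy γ r with h0 | hbig
  · exact hu ((hrep x₁ hx₁).trans (h0 x₁))
  · obtain ⟨x, hx, hCx⟩ := hbig C
    have := hC x
    rw [hrep x hx] at this
    linarith

end SingularKernel

/-! ## 2. The vorton velocity kernel (2) = the tree's Biot–Savart kernel -/

/-- `v(γ, p)(x) = (4π‖x − p‖³)⁻¹ γ × (x − p)`. -/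
def vort (γ p x : E3) : E3 := biotSavartKernel (x - p) γ

/-- Unfolding `vort`. -/
theorem vort_def (γ p x : E3) : vort γ p x = (4 * Real.pi * ‖x - p‖ ^ 3)⁻¹ • cross γ (x - p) := rfl

/-- The cross product is additive in its first argument. -/
theorem cross_add_left (a b c : E3) : cross (a + b) c = cross a c + cross b c := by
  rw [← crossCLM_apply, map_add, add_apply, crossCLM_apply, crossCLM_apply]

/-- The cross product is homogeneous in its second argument. -/
theorem cross_smul_right' (a c : E3) (s : ℝ) : cross a (s • c) = s • cross a c := by
  rw [← crossCLM_apply, map_smul, crossCLM_apply]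

/-- `‖a × e‖ = ‖a‖` for a unit vector `e ⊥ a`. -/
theorem norm_cross_of_perp_unit {a e : E3} (he : ‖e‖ = 1) (hae : ⟪a, e⟫ = 0) :
    ‖cross a e‖ = ‖a‖ := by
  rw [norm_cross, (InnerProductGeometry.inner_eq_zero_iff_angle_eq_pi_div_two a e).1 hae,
    Real.sin_pi_div_two, he]
  ring

/-- Every vector of `ℝ³` has a unit vector perpendicular to it. -/
theorem exists_unit_perp (a : E3) : ∃ e : E3, ‖e‖ = 1 ∧ ⟪a, e⟫ = 0 := by
  by_cases h : a 0 = 0 ∧ a 1 = 0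
  · refine ⟨EuclideanSpace.single 0 1, by simp, ?_⟩
    rw [EuclideanSpace.inner_single_right]; simp [h.1]
  · set w : E3 := (-(a 1)) • EuclideanSpace.single 0 (1 : ℝ) + (a 0) • EuclideanSpace.single 1 1
      with hw
    have hw0 : w ≠ 0 := by
      intro h0
      have e0 := congrArg (fun v : E3 => v 0) h0
      have e1 := congrArg (fun v : E3 => v 1) h0
      simp [hw] at e0 e1
      exact h ⟨e1, e0⟩
    have hnw : ‖w‖ ≠ 0 := norm_ne_zero_iff.2 hw0
    refine ⟨‖w‖⁻¹ • w, ?_, ?_⟩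
    · rw [norm_smul, norm_inv, norm_norm, inv_mul_cancel₀ hnw]
    · rw [real_inner_smul_right]
      have : ⟪a, w⟫ = 0 := by
        rw [hw, inner_add_right, real_inner_smul_right, real_inner_smul_right,
          EuclideanSpace.inner_single_right, EuclideanSpace.inner_single_right]
        simp; ring
      rw [this, mul_zero]

/-- Along a unit direction `e ⊥ γ`: `‖v(γ,p)(p + s e)‖ = ‖γ‖/(4π s²)` for `s > 0`. -/
theorem norm_vort_perp {γ e p : E3} (he : ‖e‖ = 1) (hγe : ⟪γ, e⟫ = 0) {s : ℝ} (hs : 0 < s) :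
    ‖vort γ p (p + s • e)‖ = ‖γ‖ / (4 * Real.pi * s ^ 2) := by
  rw [vort_def, add_sub_cancel_left, cross_smul_right', norm_smul, norm_smul, norm_smul, he,
    norm_cross_of_perp_unit he hγe, Real.norm_of_nonneg hs.le, mul_one, norm_inv,
    Real.norm_of_nonneg (by positivity)]
  field_simp

/-- **The vorton velocity is a singular kernel** (additive, continuous off the pole, `‖v(p + s e)‖ = ‖γ‖/(4π s²)`). -/
theorem singularKernel_vort : SingularKernel vort where
  add γ γ' p x := by
    rw [vort_def, vort_def, vort_def, cross_add_left, smul_add]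
  zero p x := biotSavartKernel_zero_right _
  cont γ p x hx := by
    show ContinuousAt (fun y => (4 * Real.pi * ‖y - p‖ ^ 3)⁻¹ • cross γ (y - p)) x
    have hne : 4 * Real.pi * ‖x - p‖ ^ 3 ≠ 0 := by
      have : 0 < ‖x - p‖ := norm_pos_iff.2 (sub_ne_zero.2 hx)
      positivity
    refine ContinuousAt.smul (f := fun y : E3 => (4 * Real.pi * ‖y - p‖ ^ 3)⁻¹)
      (g := fun y : E3 => cross γ (y - p)) ?_ ?_
    · exact ((continuous_const.mul ((continuous_norm.comp (continuous_id.sub continuous_const)).pow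
        3)).continuousAt).inv₀ hne
    · exact ((crossCLM γ).continuous.comp (continuous_id.sub continuous_const)).continuousAt
  blowup γ p hγ M δ hδ := by
    obtain ⟨e, he, hγe⟩ := exists_unit_perp γ
    have hγn : 0 < ‖γ‖ := norm_pos_iff.2 hγ
    set M' : ℝ := max M 1 with hM'
    have hM'0 : 0 < M' := lt_of_lt_of_le one_pos (le_max_right _ _)
    set s₁ : ℝ := Real.sqrt (‖γ‖ / (16 * Real.pi * M')) with hs₁
    have hs₁0 : 0 < s₁ := Real.sqrt_pos.2 (by positivity)
    set s : ℝ := min (δ / 2) s₁ with hs_def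
    have hs0 : 0 < s := lt_min (by linarith) hs₁0
    have hsδ : s < δ := lt_of_le_of_lt (min_le_left _ _) (by linarith)
    have hss₁ : s ≤ s₁ := min_le_right _ _
    refine ⟨p + s • e, ?_, ?_, ?_⟩
    · intro h
      have : s • e = 0 := by simpa using h
      rcases smul_eq_zero.1 this with h1 | h1
      · exact absurd h1 hs0.ne'
      · rw [h1, norm_zero] at he; exact absurd he (by norm_num)
    · rw [dist_eq_norm, add_sub_cancel_left, norm_smul, he, mul_one, Real.norm_of_nonneg hs0.le]
      exact hsδ
    · rw [norm_vort_perp he hγe hs0]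
      have hsq : s ^ 2 ≤ s₁ ^ 2 := by gcongr
      have hs₁sq : s₁ ^ 2 = ‖γ‖ / (16 * Real.pi * M') := by
        rw [hs₁, Real.sq_sqrt (by positivity)]
      have hpi : 0 < Real.pi := Real.pi_pos
      calc M ≤ M' := le_max_left _ _
        _ < ‖γ‖ / (4 * Real.pi * s ^ 2) := by
          rw [lt_div_iff₀ (by positivity)]
          calc M' * (4 * Real.pi * s ^ 2) ≤ M' * (4 * Real.pi * s₁ ^ 2) := by gcongr
            _ = ‖γ‖ / 4 := by rw [hs₁sq]; field_simp; ring
            _ < ‖γ‖ := by linarith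

/-! ## 3. The witness: a `C_c^∞` divergence-free field equal to the rotation `(−x₁, x₀, 0)` on `B(0,3)` -/

/-- Standard basis vector `e_i`. -/
abbrev bv (i : Fin 3) : E3 := EuclideanSpace.single i (1 : ℝ)

/-- Coordinate functional `x ↦ x i` as a continuous linear map. -/
abbrev pr (i : Fin 3) : E3 →L[ℝ] ℝ := EuclideanSpace.proj i

/-- The rigid rotation `R x = (−x₁, x₀, 0)`. -/
def R : E3 →L[ℝ] E3 := (-(pr 1)).smulRight (bv 0) + (pr 0).smulRight (bv 1)

/-- The vector potential `Ψ(x) = −½ (x₀² + x₁²) e₂`. -/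
def Psi (x : E3) : E3 := (-(1/2 : ℝ) * (pr 0 x * pr 0 x + pr 1 x * pr 1 x)) • bv 2

/-- The derivative of `Ψ`. -/
def DPsi (x : E3) : E3 →L[ℝ] E3 :=
  ((-(1/2 : ℝ)) • ((pr 0 x • (pr 0 : E3 →L[ℝ] ℝ) + pr 0 x • pr 0) +
    (pr 1 x • (pr 1 : E3 →L[ℝ] ℝ) + pr 1 x • pr 1))).smulRight (bv 2)

/-- `DΨ(x) = DPsi x`. -/
theorem hasFDerivAt_Psi (x : E3) : HasFDerivAt Psi (DPsi x) x := by
  have h0 := (pr 0).hasFDerivAt (x := x)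
  have h1 := (pr 1).hasFDerivAt (x := x)
  exact (((h0.mul h0).add (h1.mul h1)).const_mul (-(1/2 : ℝ))).smul_const (bv 2)

/-- `Ψ` is smooth. -/
theorem contDiff_Psi : ContDiff ℝ ∞ Psi :=
  (contDiff_const.mul (((pr 0).contDiff.mul (pr 0).contDiff).add
    ((pr 1).contDiff.mul (pr 1).contDiff))).smul contDiff_const

/-- `curl Ψ = R` everywhere. -/
theorem curl_Psi (x : E3) : curl Psi x = R x := by
  have hD : fderiv ℝ Psi x = DPsi x := (hasFDerivAt_Psi x).fderiv
  ext i
  fin_cases i <;> (simp [curl, hD, DPsi, R, Fin.ext_iff]; try ring)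

/-- A smooth bump `φ ≡ 1` on `B̄(0,3)`, supported in `B(0,4)`. -/
def φb : ContDiffBump (0 : E3) := ⟨3, 4, by norm_num, by norm_num⟩
/-- `Wp = φ Ψ`. -/
def Wp (x : E3) : E3 := φb x • Psi x
/-- **The witness** `u₀ = curl (φ Ψ)`. -/
def u0 : E3 → E3 := curl Wp

/-- `φ Ψ` is smooth. -/
theorem contDiff_Wp : ContDiff ℝ ∞ Wp := φb.contDiff.smul contDiff_Psi

/-- The witness is `C^∞`. -/
theorem contDiff_u0 : ContDiff ℝ ∞ u0 :=
  contDiff_infty.2 fun n => contDiff_curl (n := n) (by exact_mod_cast contDiff_infty.1 contDiff_Wp (n + 1))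

/-- The witness is continuous. -/
theorem continuous_u0 : Continuous u0 := contDiff_u0.continuous

/-- The witness is divergence free (`div curl = 0`). -/
theorem isDivFree_u0 : NSWave0.IsDivFree u0 := fun x =>
  divergence_curl_eq_zero_holds Wp (contDiff_infty.1 contDiff_Wp 2) x

/-- `φ Ψ` is compactly supported. -/
theorem hasCompactSupport_Wp : HasCompactSupport Wp :=
  φb.hasCompactSupport.smul_right (f' := Psi)

/-- The witness is compactly supported. -/
theorem hasCompactSupport_u0 : HasCompactSupport u0 := hasCompactSupport_curl hasCompactSupport_Wp

/-- The witness is in Fefferman's class (4) (compact support). -/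
theorem hasRapidSpatialDecay_u0 : HasRapidSpatialDecay u0 :=
  HasRapidSpatialDecay.of_hasCompactSupport contDiff_u0 hasCompactSupport_u0

/-- `u₀` is bounded. -/
theorem exists_bound_u0 : ∃ C : ℝ, ∀ x, ‖u0 x‖ ≤ C :=
  continuous_u0.bounded_above_of_compact_support hasCompactSupport_u0 |>.imp fun _ h => h

/-- On the plateau ball `B(0,3)`, `u₀ = R`. -/
theorem u0_eq_on_ball {x : E3} (hx : x ∈ ball (0 : E3) 3) : u0 x = R x := by
  have hW : Wp =ᶠ[𝓝 x] Psi := by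
    filter_upwards [isOpen_ball.mem_nhds hx] with y hy
    have h1 : φb y = 1 := φb.one_of_mem_closedBall (ball_subset_closedBall hy)
    simp [Wp, h1]
  show curl Wp x = R x
  rw [curl_eq_curlCLM, hW.fderiv_eq, ← curl_eq_curlCLM, curl_Psi]

/-- `u₀ (t e₀) = t e₁ ≠ 0` for `0 < t < 3`. -/
theorem u0_ne_zero_of {t : ℝ} (ht0 : 0 < t) (ht3 : t < 3) : u0 (t • bv 0) ≠ 0 := by
  have hmem : t • bv 0 ∈ ball (0 : E3) 3 := by
    rw [mem_ball_zero_iff, norm_smul, Real.norm_of_nonneg ht0.le]; simp [ht3]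
  rw [u0_eq_on_ball hmem]
  intro h
  have := congrArg (fun v : E3 => v 1) h
  simp [R] at this
  exact ht0.ne' this

/-- Off any finite set of positions there is a point `t e₀`, `0 < t < 3` (where `u₀ ≠ 0`). -/
theorem exists_good_point {ι : Type*} [Fintype ι] (r : ι → E3) :
    ∃ t : ℝ, 0 < t ∧ t < 3 ∧ ∀ i, t • bv 0 ≠ r i := by
  classical
  have hinj : Set.InjOn (fun t : ℝ => t • bv 0) univ := by
    intro a _ b _ hab
    have := congrArg (fun v : E3 => v 0) hab
    simpa using this
  have hfin : ((fun t : ℝ => t • bv 0) ⁻¹' (↑(Finset.univ.image r) : Set E3)).Finite :=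
    (Finset.finite_toSet _).preimage (hinj.mono (subset_univ _))
  obtain ⟨t, ht, htn⟩ := ((Set.Ioo_infinite (by norm_num : (0:ℝ) < 3)).sdiff hfin).nonempty
  refine ⟨t, ht.1, ht.2, fun i hi => htn ?_⟩
  simp only [mem_preimage, Finset.coe_image, Finset.coe_univ, image_univ, mem_range]
  exact ⟨i, hi.symm⟩

/-- **No finite vorton representation of the witness** (velocity level, off the positions). -/
theorem u0_not_finite_vorton_sum {ι : Type*} [Fintype ι] (γ r : ι → E3)
    (hrep : ∀ x, (∀ i, x ≠ r i) → u0 x = ∑ i, vort (γ i) (r i) x) : False := by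
  obtain ⟨C, hC⟩ := exists_bound_u0
  obtain ⟨t, ht0, ht3, ht⟩ := exists_good_point r
  exact singularKernel_vort.not_repr hC γ r ht (u0_ne_zero_of ht0 ht3) hrep


/-! ## 4. The kill: `¬ Step_repr_exact` (skeleton p552632 l.164, binder 1 of `claim_of_steps` l.274) -/

/-- The skeleton's `cross` (Mathlib's `crossProduct` transported to `EuclideanSpace`) is the tree's `cross`. -/
theorem aks_cross_eq (a b : E3) : Literature.Claims.NS.Aksman2026.cross a b = cross a b := rfl

/-- The skeleton's vorton velocity (2) is the kernel `vort` (= `biotSavartKernel (x − r) γ`). -/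
theorem vortonVel_eq (r γ x : E3) : Literature.Claims.NS.Aksman2026.vortonVel r γ x = vort γ r x := by
  rw [vort_def, Literature.Claims.NS.Aksman2026.vortonVel, one_div, aks_cross_eq]

/-- The skeleton's superposition (5) is the finite `vort`-sum. -/
theorem superpos_eq {N : ℕ} (R Γ : Fin N → E3) (x : E3) :
    Literature.Claims.NS.Aksman2026.superpos R Γ x = ∑ α, vort (Γ α) (R α) x := by
  simp only [Literature.Claims.NS.Aksman2026.superpos, vortonVel_eq]

/-- A finite superposition is continuous off its poles. -/
theorem continuousAt_superpos {N : ℕ} (R Γ : Fin N → E3) {x : E3} (hx : ∀ α, x ≠ R α) :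
    ContinuousAt (Literature.Claims.NS.Aksman2026.superpos R Γ) x := by
  have h : Literature.Claims.NS.Aksman2026.superpos R Γ = fun y => ∑ α, vort (Γ α) (R α) y :=
    funext (superpos_eq R Γ)
  rw [h]
  exact tendsto_finsetSum Finset.univ fun α _ => singularKernel_vort.cont (Γ α) (R α) x (hx α)

/-- From the a.e. identity to the pointwise identity off the poles: both sides are continuous on the open
complement of the finitely many poles, and Lebesgue measure charges open sets. -/
theorem eq_off_poles {u : E3 → E3} (hu : Continuous u) {N : ℕ} (R Γ : Fin N → E3)
    (hae : ∀ᵐ x : E3, u x = Literature.Claims.NS.Aksman2026.superpos R Γ x) :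
    ∀ x, (∀ α, x ≠ R α) → u x = ∑ α, vort (Γ α) (R α) x := by
  have hUo : IsOpen (Set.range R)ᶜ := (Set.finite_range R).isClosed.isOpen_compl
  have hmem : ∀ {x : E3}, x ∈ (Set.range R)ᶜ → ∀ α, x ≠ R α := fun hx α h => hx ⟨α, h.symm⟩
  have heq : EqOn u (Literature.Claims.NS.Aksman2026.superpos R Γ) (Set.range R)ᶜ :=
    MeasureTheory.Measure.eqOn_open_of_ae_eq (MeasureTheory.ae_restrict_of_ae hae) hUo hu.continuousOn
      fun x hx => (continuousAt_superpos R Γ (hmem hx)).continuousWithinAt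
  intro x hx
  rw [heq (fun ⟨α, h⟩ => hx α h.symm), superpos_eq]

/-- **C175 VERDICT OBJECT.** First failing step = `Literature.Claims.NS.Aksman2026.Step_repr_exact` (p.3
l.38–39 with (5) p.3 l.31–37 / (2) p.2 l.40–49; binder 1 `hex` of `claim_of_steps` l.274) (print p.3), class =
false lemma (countermodel: the compactly supported smooth divergence-free field `u₀ = curl(φ Ψ)`, equal to the
rigid rotation `(−x₁, x₀, 0)` on `B(0,3)`, is bounded and nonzero off any finite pole set, while a finite
superposition of vorton velocities (2) is identically zero or unbounded off its poles). -/
theorem not_Step_repr_exact : ¬ Literature.Claims.NS.Aksman2026.Step_repr_exact := by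
  intro h
  obtain ⟨N, R, Γ, _hinj, hae⟩ := h u0 contDiff_u0 isDivFree_u0 hasRapidSpatialDecay_u0
  exact u0_not_finite_vorton_sum Γ R (eq_off_poles continuous_u0 R Γ hae)

end

end Summit.NavierStokesRegularity.NavierStokesRegularity.Theorems.Aksman2026
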